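import Summits.CriticalPhenomena.PercolationContinuityZ3.Theorems.PercNearOneGluingNoHeavyLowerTailKnQuestion8CoefficientwiseIslandClass
import Summits.CriticalPhenomena.PercolationContinuityZ3.Theorems.PercNearOneGluingNoHeavyLowerTailDualBHKBlock
import Summits.CriticalPhenomena.PercolationContinuityZ3.Theorems.PercNearOneGluingNoHeavyLowerTailKnQuestion8CoefficientwiseGluing
import HarnessLib

/-!
# Islands III: the ISLAND FACTORISATION of the point row (prim-lf-2 gen 36, memo CW-RESIDUE-gen36 §2, THEOREM 2.4)

Support file (`--supports stmt-CriticalPhenomena-4575`, closed), prover `prim-lf-2` (gen 36).  No definitions, no named facts,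
      no sorries; standard axioms.

Setting as in …CoefficientwiseIsland / …IslandMax: multigraph `ends : ι
      → Sym2 V`, vertex finset `Vs ∋ x`, edge set `E`, root `x`, points `u, w` (`w ≠ x`), wall set `Z`;
colourings `s ⊆ E`; `C(t) = openCluster (ends '' t) x`; `σ_v(s) = 1[v ∈ C(s)] − 1[v ∈ C(E \ s)]`; point row `P = Σ_{s : Z off the zone} σ_u σ_w`.  For
`Y ⊆ Vs` with `x ∈ Y ∌ w`: `E_Y` = edges inside `Y`; `N_isl(Y)` = number of colourings `s₀
      ⊆ E_Y` for which `Y` is an island (every boundary vertex red- and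
blue-reachable from `x` inside `Y`) and the wall vertices in `Y` are off the zone; the QUOTIENT colourings are `s₁
      ⊆ E \ E_Y` read with all of `E_Y` in both colours;
`s₁` is PRIME if no `Y'` with `Y ⊊ Y' ⊆ Vs`, `w ∉ Y'` is an island of the quotient colouring; `R_Y`
      = `Σ` over the prime quotient colourings with the wall
vertices outside `Y` off the zone of `σ_u σ_w` (read on the quotient).
(…IslandClass: `islandClass_sum` — for `u ∉ Y` the class of the maximal island `Y` contributes `N_isl(Y) · R_Y`.)
* `Coefficientwise.islandClass_sum_eq_zero` — for `u ∈ Y` that sum vanishes (σ_u is read inside the island, σ_w on the quotient,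
      and the quotient colour swap
  preserves primality and the wall);
* `Coefficientwise.pointRow_eq_sum_islands` — **ISLAND FACTORISATION**:  `P(G;x,Z;u,w) = Σ_{Y ⊆ Vs : x ∈ Y, u,w ∉ Y} N_isl(Y) · R_Y`.
Since every `N_isl(Y) ≥ 0`, CONJECTURE PRIME POSITIVITY (`R ≥ 0` for every rooted multigraph, wall set and points; census memo §3: 0 negatives through
n = 7 all m, n = 8 m ≤ 12, structured families,
      random n ≤ 12) implies the point row of the coefficientwise programme for every graph and every wall set —
`Coefficientwise.pointRow_nonneg_of_prime_nonneg`.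
[cite: KozmaNitzan2024, Questions 8–9 (§5.5 p. 36) (context: the Question-8 pocket covariance programme)]
-/

namespace Summit.CriticalPhenomena.PercolationContinuityZ3.Theorems

open Finset Literature.Probability.Percolation

namespace Coefficientwise

variable {ι V : Type*}

open Classical in
/-- The prime quotient sum of a single sign vanishes: `Σ_{s₁ prime, wall} σ_w(s₁)
      = 0` (the quotient colour swap `s₁ ↦ (E \ E_Y) \ s₁` preserves the wall and
primality and negates `σ_w`). [cite: KozmaNitzan2024, §5.5 (context only)] -/
theorem primeSum_single_eq_zero (ends : ι → Sym2 V) (E : Finset ι) (Vs : Finset V) (x w : V) (Z : Set V) (Y : Finset V) :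
    ∑ s₁ ∈ (E \ E.filter (fun i => ∀ y ∈ ends i, y ∈ Y)).powerset,
        (if (∀ z ∈ Z, z ∉ Y → z ∉ openCluster (ends '' (↑(s₁ ∪ E.filter (fun i => ∀ y ∈ ends i, y ∈ Y)) : Set ι)) x ∧ z ∉ openCluster
              (ends '' (↑(((E \ E.filter (fun i => ∀ y ∈ ends i, y ∈ Y)) \ s₁) ∪ E.filter (fun i => ∀ y ∈ ends i, y ∈ Y)) : Set ι)) x) ∧
            (∀ Y' : Finset V, Y ⊆ Y' → Y ≠ Y' → Y' ⊆ Vs → w ∉ Y' →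
          ¬ (∀ t ∈ Y', t ≠ x → (∃ i ∈ E, ∃ t', ends i = s(t, t') ∧ t' ∉ Y') →
          t ∈ openCluster (ends '' (↑(((s₁ ∪ E.filter (fun i => ∀ y ∈ ends i, y ∈ Y))).filter (fun i => ∀ y ∈ ends i, y ∈ Y')) : Set ι)) x
                ∧ t ∈ openCluster (ends '' (↑((((E \ E.filter (fun i => ∀ y ∈ ends i, y ∈ Y)) \ s₁)
                ∪ E.filter (fun i => ∀ y ∈ ends i, y ∈ Y)).filter (fun i => ∀ y ∈ ends i, y ∈ Y')) : Set ι)) x))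
          then ((if w ∈ openCluster (ends '' (↑(s₁ ∪ E.filter (fun i => ∀ y ∈ ends i, y ∈ Y)) : Set ι)) x then (1 : ℝ) else 0)
                - (if w ∈ openCluster (ends '' (↑(((E \ E.filter (fun i => ∀ y ∈ ends i, y ∈ Y)) \ s₁)
                ∪ E.filter (fun i => ∀ y ∈ ends i, y ∈ Y)) : Set ι)) x then (1 : ℝ) else 0)) else 0) = 0 := by
  set EY : Finset ι := E.filter (fun i => ∀ y ∈ ends i, y ∈ Y) with hEY
  set H : Finset ι → ℝ := fun s₁ =>
      (if (∀ z ∈ Z, z ∉ Y → z ∉ openCluster (ends '' (↑(s₁ ∪ EY) : Set ι)) x ∧ z ∉ openCluster (ends '' (↑(((E \ EY) \ s₁) ∪ EY) : Set ι)) x) ∧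
          (∀ Y' : Finset V, Y ⊆ Y' → Y ≠ Y' → Y' ⊆ Vs → w ∉ Y' →
          ¬ (∀ t ∈ Y', t ≠ x → (∃ i ∈ E, ∃ t', ends i = s(t, t') ∧ t' ∉ Y') →
          t ∈ openCluster (ends '' (↑(((s₁ ∪ EY)).filter (fun i => ∀ y ∈ ends i, y ∈ Y')) : Set ι)) x ∧ t ∈ openCluster
                (ends '' (↑((((E \ EY) \ s₁) ∪ EY).filter (fun i => ∀ y ∈ ends i, y ∈ Y')) : Set ι)) x))
        then ((if w ∈ openCluster (ends '' (↑(s₁ ∪ EY) : Set ι)) x then (1 : ℝ) else 0) - (if w ∈ openCluster (ends '' (↑(((E \ EY) \ s₁)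
              ∪ EY) : Set ι)) x then (1 : ℝ) else 0)) else 0) with hH
  have hswap : ∀ c₁ ∈ (E \ EY).powerset, H ((E \ EY) \ c₁) = - H c₁ := by
    intro c₁ hc₁
    rw [Finset.mem_powerset] at hc₁
    have e : (E \ EY) \ ((E \ EY) \ c₁) = c₁ := Finset.sdiff_sdiff_eq_self hc₁
    simp only [hH]
    rw [e]
    by_cases h1 : (∀ z ∈ Z, z ∉ Y → z ∉ openCluster (ends '' (↑(c₁ ∪ EY) : Set ι)) x ∧ z ∉ openCluster (ends '' (↑(((E \ EY) \ c₁)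
          ∪ EY) : Set ι)) x) ∧
        (∀ Y' : Finset V, Y ⊆ Y' → Y ≠ Y' → Y' ⊆ Vs → w ∉ Y' →
          ¬ (∀ t ∈ Y', t ≠ x → (∃ i ∈ E, ∃ t', ends i = s(t, t') ∧ t' ∉ Y') →
          t ∈ openCluster (ends '' (↑(((c₁ ∪ EY)).filter (fun i => ∀ y ∈ ends i, y ∈ Y')) : Set ι)) x ∧ t ∈ openCluster
                (ends '' (↑((((E \ EY) \ c₁) ∪ EY).filter (fun i => ∀ y ∈ ends i, y ∈ Y')) : Set ι)) x))
    · have h2 : (∀ z ∈ Z, z ∉ Y → z ∉ openCluster (ends '' (↑(((E \ EY) \ c₁) ∪ EY) : Set ι)) x ∧ z ∉ openCluster (ends '' (↑(c₁ ∪ EY) : Set ι)) x) ∧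
          (∀ Y' : Finset V, Y ⊆ Y' → Y ≠ Y' → Y' ⊆ Vs → w ∉ Y' →
          ¬ (∀ t ∈ Y', t ≠ x → (∃ i ∈ E, ∃ t', ends i = s(t, t') ∧ t' ∉ Y') →
          t ∈ openCluster (ends '' (↑(((((E \ EY) \ c₁) ∪ EY)).filter (fun i => ∀ y ∈ ends i, y ∈ Y')) : Set ι)) x ∧ t ∈ openCluster
                (ends '' (↑((c₁ ∪ EY).filter (fun i => ∀ y ∈ ends i, y ∈ Y')) : Set ι)) x)) := by
        refine ⟨fun z hz hzY => ⟨(h1.1 z hz hzY).2, (h1.1 z hz hzY).1⟩, fun Y' hYY' hne hY'V hwY' hI => ?_⟩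
        exact h1.2 Y' hYY' hne hY'V hwY' fun t' ht' ht'x hbd => ⟨(hI t' ht' ht'x hbd).2, (hI t' ht' ht'x hbd).1⟩
      rw [if_pos h1, if_pos h2]
      ring
    · have h2 : ¬ ((∀ z ∈ Z, z ∉ Y → z ∉ openCluster (ends '' (↑(((E \ EY) \ c₁) ∪ EY) : Set ι)) x ∧ z ∉ openCluster (ends '' (↑(c₁
          ∪ EY) : Set ι)) x) ∧
          (∀ Y' : Finset V, Y ⊆ Y' → Y ≠ Y' → Y' ⊆ Vs → w ∉ Y' →
          ¬ (∀ t ∈ Y', t ≠ x → (∃ i ∈ E, ∃ t', ends i = s(t, t') ∧ t' ∉ Y') →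
          t ∈ openCluster (ends '' (↑(((((E \ EY) \ c₁) ∪ EY)).filter (fun i => ∀ y ∈ ends i, y ∈ Y')) : Set ι)) x ∧ t ∈ openCluster
                (ends '' (↑((c₁ ∪ EY).filter (fun i => ∀ y ∈ ends i, y ∈ Y')) : Set ι)) x))) := by
        intro h2
        refine h1 ⟨fun z hz hzY => ⟨(h2.1 z hz hzY).2, (h2.1 z hz hzY).1⟩, fun Y' hYY' hne hY'V hwY' hI => ?_⟩
        exact h2.2 Y' hYY' hne hY'V hwY' fun t' ht' ht'x hbd => ⟨(hI t' ht' ht'x hbd).2, (hI t' ht' ht'x hbd).1⟩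
      rw [if_neg h1, if_neg h2, neg_zero]
  have key : ∑ t ∈ (E \ EY).powerset, H t = ∑ t ∈ (E \ EY).powerset, H ((E \ EY) \ t) :=
    (sum_powerset_sdiff (E \ EY) H).symm
  have key2 : ∑ t ∈ (E \ EY).powerset, H ((E \ EY) \ t) = - ∑ t ∈ (E \ EY).powerset, H t := by
    rw [← Finset.sum_neg_distrib]
    exact Finset.sum_congr rfl hswap
  show ∑ t ∈ (E \ EY).powerset, H t = 0
  linarith [key, key2]

open Classical in
/-- The class of a maximal island containing `u` contributes zero (`w ∉ Y`, `u ∈ Y`). [cite: KozmaNitzan2024, Questions 8–9 (§5.5 p. 36) (context)] -/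
theorem islandClass_sum_eq_zero (ends : ι → Sym2 V) (E : Finset ι) (Vs : Finset V) (x u w : V) (Z : Set V) (Y : Finset V)
    (hYV : Y ⊆ Vs) (hxY : x ∈ Y) (huY : u ∈ Y) (hwY : w ∉ Y) (hwx : w ≠ x) :
    ∑ s₀ ∈ (E.filter (fun i => ∀ y ∈ ends i, y ∈ Y)).powerset, ∑ s₁ ∈ (E \ E.filter (fun i => ∀ y ∈ ends i, y ∈ Y)).powerset,
        (if (Vs.filter (fun v : V => ∃ Y : Finset V, Y ⊆ Vs ∧ x ∈ Y ∧ w ∉ Y ∧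
        (∀ t ∈ Y, t ≠ x → (∃ i ∈ E, ∃ t', ends i = s(t, t') ∧ t' ∉ Y) →
          t ∈ openCluster (ends '' (↑((s₀ ∪ s₁).filter (fun i => ∀ y ∈ ends i, y ∈ Y)) : Set ι)) x ∧ t ∈ openCluster (ends '' (↑((E \ (s₀
                ∪ s₁)).filter (fun i => ∀ y ∈ ends i, y ∈ Y)) : Set ι)) x) ∧ v ∈ Y)) = Y ∧
            (∀ z ∈ Z, z ∉ openCluster (ends '' (↑(s₀ ∪ s₁) : Set ι)) x ∧ z ∉ openCluster (ends '' (↑(E \ (s₀ ∪ s₁)) : Set ι)) x)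
          then ((if u ∈ openCluster (ends '' (↑(s₀ ∪ s₁) : Set ι)) x then (1 : ℝ) else 0) - (if u ∈ openCluster (ends '' (↑(E \ (s₀
                ∪ s₁)) : Set ι)) x then (1 : ℝ) else 0)) *
            ((if w ∈ openCluster (ends '' (↑(s₀ ∪ s₁) : Set ι)) x then (1 : ℝ) else 0) - (if w ∈ openCluster (ends '' (↑(E \ (s₀
                  ∪ s₁)) : Set ι)) x then (1 : ℝ) else 0)) else 0) = 0 := by
  -- rewrite each term as (island indicator × σ_u read inside) × (prime quotient indicator × σ_w read on the quotient)
  have hterm : ∀ s₀ ∈ (E.filter (fun i => ∀ y ∈ ends i, y ∈ Y)).powerset, ∀ s₁ ∈ (E \ E.filter (fun i => ∀ y ∈ ends i, y ∈ Y)).powerset,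
      (if (Vs.filter (fun v : V => ∃ Y : Finset V, Y ⊆ Vs ∧ x ∈ Y ∧ w ∉ Y ∧
        (∀ t ∈ Y, t ≠ x → (∃ i ∈ E, ∃ t', ends i = s(t, t') ∧ t' ∉ Y) →
          t ∈ openCluster (ends '' (↑((s₀ ∪ s₁).filter (fun i => ∀ y ∈ ends i, y ∈ Y)) : Set ι)) x ∧ t ∈ openCluster (ends '' (↑((E \ (s₀
                ∪ s₁)).filter (fun i => ∀ y ∈ ends i, y ∈ Y)) : Set ι)) x) ∧ v ∈ Y)) = Y ∧
          (∀ z ∈ Z, z ∉ openCluster (ends '' (↑(s₀ ∪ s₁) : Set ι)) x ∧ z ∉ openCluster (ends '' (↑(E \ (s₀ ∪ s₁)) : Set ι)) x)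
        then ((if u ∈ openCluster (ends '' (↑(s₀ ∪ s₁) : Set ι)) x then (1 : ℝ) else 0) - (if u ∈ openCluster (ends '' (↑(E \ (s₀
              ∪ s₁)) : Set ι)) x then (1 : ℝ) else 0)) *
          ((if w ∈ openCluster (ends '' (↑(s₀ ∪ s₁) : Set ι)) x then (1 : ℝ) else 0) - (if w ∈ openCluster (ends '' (↑(E \ (s₀
                ∪ s₁)) : Set ι)) x then (1 : ℝ) else 0)) else 0)
      = (if (∀ t ∈ Y, t ≠ x → (∃ i ∈ E, ∃ t', ends i = s(t, t') ∧ t' ∉ Y) →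
          t ∈ openCluster (ends '' (↑(s₀) : Set ι)) x ∧ t ∈ openCluster (ends '' (↑(E.filter (fun i => ∀ y ∈ ends i, y ∈ Y) \ s₀) : Set ι)) x) ∧
            (∀ z ∈ Z, z ∈ Y → z ∉ openCluster (ends '' (↑(s₀) : Set ι)) x ∧ z ∉ openCluster
                  (ends '' (↑(E.filter (fun i => ∀ y ∈ ends i, y ∈ Y) \ s₀) : Set ι)) x)
          then ((if u ∈ openCluster (ends '' (↑(s₀) : Set ι)) x then (1 : ℝ) else 0) - (if u ∈ openCluster
                (ends '' (↑(E.filter (fun i => ∀ y ∈ ends i, y ∈ Y) \ s₀) : Set ι)) x then (1 : ℝ) else 0)) else 0) *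
        (if (∀ z ∈ Z, z ∉ Y → z ∉ openCluster (ends '' (↑(s₁ ∪ E.filter (fun i => ∀ y ∈ ends i, y ∈ Y)) : Set ι)) x ∧ z ∉ openCluster
              (ends '' (↑(((E \ E.filter (fun i => ∀ y ∈ ends i, y ∈ Y)) \ s₁) ∪ E.filter (fun i => ∀ y ∈ ends i, y ∈ Y)) : Set ι)) x) ∧
            (∀ Y' : Finset V, Y ⊆ Y' → Y ≠ Y' → Y' ⊆ Vs → w ∉ Y' →
          ¬ (∀ t ∈ Y', t ≠ x → (∃ i ∈ E, ∃ t', ends i = s(t, t') ∧ t' ∉ Y') →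
          t ∈ openCluster (ends '' (↑(((s₁ ∪ E.filter (fun i => ∀ y ∈ ends i, y ∈ Y))).filter (fun i => ∀ y ∈ ends i, y ∈ Y')) : Set ι)) x
                ∧ t ∈ openCluster (ends '' (↑((((E \ E.filter (fun i => ∀ y ∈ ends i, y ∈ Y)) \ s₁)
                ∪ E.filter (fun i => ∀ y ∈ ends i, y ∈ Y)).filter (fun i => ∀ y ∈ ends i, y ∈ Y')) : Set ι)) x))
          then ((if w ∈ openCluster (ends '' (↑(s₁ ∪ E.filter (fun i => ∀ y ∈ ends i, y ∈ Y)) : Set ι)) x then (1 : ℝ) else 0)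
                - (if w ∈ openCluster (ends '' (↑(((E \ E.filter (fun i => ∀ y ∈ ends i, y ∈ Y)) \ s₁)
                ∪ E.filter (fun i => ∀ y ∈ ends i, y ∈ Y)) : Set ι)) x then (1 : ℝ) else 0)) else 0) := by
    intro s₀ hs₀ s₁ hs₁
    rw [Finset.mem_powerset] at hs₀ hs₁
    obtain ⟨hclass, hread⟩ := islandClass_pointwise ends E Vs x w Z Y hYV hxY hwY hwx s₀ s₁ hs₀ hs₁
    by_cases hP : (∀ t ∈ Y, t ≠ x → (∃ i ∈ E, ∃ t', ends i = s(t, t') ∧ t' ∉ Y) →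
          t ∈ openCluster (ends '' (↑(s₀) : Set ι)) x ∧ t ∈ openCluster (ends '' (↑(E.filter (fun i => ∀ y ∈ ends i, y ∈ Y) \ s₀) : Set ι)) x)
    swap
    · have c1 : ¬ ((Vs.filter (fun v : V => ∃ Y : Finset V, Y ⊆ Vs ∧ x ∈ Y ∧ w ∉ Y ∧
        (∀ t ∈ Y, t ≠ x → (∃ i ∈ E, ∃ t', ends i = s(t, t') ∧ t' ∉ Y) →
          t ∈ openCluster (ends '' (↑((s₀ ∪ s₁).filter (fun i => ∀ y ∈ ends i, y ∈ Y)) : Set ι)) x ∧ t ∈ openCluster (ends '' (↑((E \ (s₀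
                ∪ s₁)).filter (fun i => ∀ y ∈ ends i, y ∈ Y)) : Set ι)) x) ∧ v ∈ Y)) = Y ∧
          (∀ z ∈ Z, z ∉ openCluster (ends '' (↑(s₀ ∪ s₁) : Set ι)) x ∧ z ∉ openCluster (ends '' (↑(E \ (s₀
                ∪ s₁)) : Set ι)) x)) := fun h => hP (hclass.mp h).1.1
      have c2 : ¬ ((∀ t ∈ Y, t ≠ x → (∃ i ∈ E, ∃ t', ends i = s(t, t') ∧ t' ∉ Y) →
          t ∈ openCluster (ends '' (↑(s₀) : Set ι)) x ∧ t ∈ openCluster (ends '' (↑(E.filter (fun i => ∀ y ∈ ends i, y ∈ Y) \ s₀) : Set ι)) x) ∧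
          (∀ z ∈ Z, z ∈ Y → z ∉ openCluster (ends '' (↑(s₀) : Set ι)) x ∧ z ∉ openCluster
                (ends '' (↑(E.filter (fun i => ∀ y ∈ ends i, y ∈ Y) \ s₀) : Set ι)) x)) := fun h => hP h.1
      rw [if_neg c1, if_neg c2, zero_mul]
    obtain ⟨hout, hin⟩ := hread hP
    have hsig : ((if u ∈ openCluster (ends '' (↑(s₀ ∪ s₁) : Set ι)) x then (1 : ℝ) else 0) - (if u ∈ openCluster (ends '' (↑(E \ (s₀
          ∪ s₁)) : Set ι)) x then (1 : ℝ) else 0)) *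
          ((if w ∈ openCluster (ends '' (↑(s₀ ∪ s₁) : Set ι)) x then (1 : ℝ) else 0) - (if w ∈ openCluster (ends '' (↑(E \ (s₀
                ∪ s₁)) : Set ι)) x then (1 : ℝ) else 0))
        = ((if u ∈ openCluster (ends '' (↑(s₀) : Set ι)) x then (1 : ℝ) else 0) - (if u ∈ openCluster
              (ends '' (↑(E.filter (fun i => ∀ y ∈ ends i, y ∈ Y) \ s₀) : Set ι)) x then (1 : ℝ) else 0)) *
          ((if w ∈ openCluster (ends '' (↑(s₁ ∪ E.filter (fun i => ∀ y ∈ ends i, y ∈ Y)) : Set ι)) x then (1 : ℝ) else 0) - (if w ∈ openCluster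
                (ends '' (↑(((E \ E.filter (fun i => ∀ y ∈ ends i, y ∈ Y)) \ s₁) ∪ E.filter (fun i => ∀ y ∈ ends i, y ∈ Y)) : Set ι)) x
                then (1 : ℝ) else 0)) := by
      have h1 : (u ∈ openCluster (ends '' (↑(s₀ ∪ s₁) : Set ι)) x) = (u ∈ openCluster (ends '' (↑(s₀) : Set ι)) x) := propext (hin u huY).1
      have h2 : (u ∈ openCluster (ends '' (↑(E \ (s₀ ∪ s₁)) : Set ι)) x) = (u ∈ openCluster
            (ends '' (↑(E.filter (fun i => ∀ y ∈ ends i, y ∈ Y) \ s₀) : Set ι)) x) := propext (hin u huY).2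
      have h3 : (w ∈ openCluster (ends '' (↑(s₀ ∪ s₁) : Set ι)) x) = (w ∈ openCluster (ends '' (↑(s₁
            ∪ E.filter (fun i => ∀ y ∈ ends i, y ∈ Y)) : Set ι)) x) := propext (hout w hwY).1
      have h4 : (w ∈ openCluster (ends '' (↑(E \ (s₀ ∪ s₁)) : Set ι)) x) = (w ∈ openCluster
            (ends '' (↑(((E \ E.filter (fun i => ∀ y ∈ ends i, y ∈ Y)) \ s₁)
            ∪ E.filter (fun i => ∀ y ∈ ends i, y ∈ Y)) : Set ι)) x) := propext (hout w hwY).2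
      simp only [h1, h2, h3, h4]
    rw [hsig]
    by_cases hA : (∀ z ∈ Z, z ∈ Y → z ∉ openCluster (ends '' (↑(s₀) : Set ι)) x ∧ z ∉ openCluster
          (ends '' (↑(E.filter (fun i => ∀ y ∈ ends i, y ∈ Y) \ s₀) : Set ι)) x)
    · by_cases hB : (∀ z ∈ Z, z ∉ Y → z ∉ openCluster (ends '' (↑(s₁ ∪ E.filter (fun i => ∀ y ∈ ends i, y ∈ Y)) : Set ι)) x ∧ z ∉ openCluster
          (ends '' (↑(((E \ E.filter (fun i => ∀ y ∈ ends i, y ∈ Y)) \ s₁) ∪ E.filter (fun i => ∀ y ∈ ends i, y ∈ Y)) : Set ι)) x) ∧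
          (∀ Y' : Finset V, Y ⊆ Y' → Y ≠ Y' → Y' ⊆ Vs → w ∉ Y' →
          ¬ (∀ t ∈ Y', t ≠ x → (∃ i ∈ E, ∃ t', ends i = s(t, t') ∧ t' ∉ Y') →
          t ∈ openCluster (ends '' (↑(((s₁ ∪ E.filter (fun i => ∀ y ∈ ends i, y ∈ Y))).filter (fun i => ∀ y ∈ ends i, y ∈ Y')) : Set ι)) x
                ∧ t ∈ openCluster (ends '' (↑((((E \ E.filter (fun i => ∀ y ∈ ends i, y ∈ Y)) \ s₁)
                ∪ E.filter (fun i => ∀ y ∈ ends i, y ∈ Y)).filter (fun i => ∀ y ∈ ends i, y ∈ Y')) : Set ι)) x))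
      · have c1 : (Vs.filter (fun v : V => ∃ Y : Finset V, Y ⊆ Vs ∧ x ∈ Y ∧ w ∉ Y ∧
        (∀ t ∈ Y, t ≠ x → (∃ i ∈ E, ∃ t', ends i = s(t, t') ∧ t' ∉ Y) →
          t ∈ openCluster (ends '' (↑((s₀ ∪ s₁).filter (fun i => ∀ y ∈ ends i, y ∈ Y)) : Set ι)) x ∧ t ∈ openCluster (ends '' (↑((E \ (s₀
                ∪ s₁)).filter (fun i => ∀ y ∈ ends i, y ∈ Y)) : Set ι)) x) ∧ v ∈ Y)) = Y ∧
            (∀ z ∈ Z, z ∉ openCluster (ends '' (↑(s₀ ∪ s₁) : Set ι)) x ∧ z ∉ openCluster (ends '' (↑(E \ (s₀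
                  ∪ s₁)) : Set ι)) x) := hclass.mpr ⟨⟨hP, hA⟩, hB⟩
        have c2 : (∀ t ∈ Y, t ≠ x → (∃ i ∈ E, ∃ t', ends i = s(t, t') ∧ t' ∉ Y) →
          t ∈ openCluster (ends '' (↑(s₀) : Set ι)) x ∧ t ∈ openCluster (ends '' (↑(E.filter (fun i => ∀ y ∈ ends i, y ∈ Y) \ s₀) : Set ι)) x) ∧
            (∀ z ∈ Z, z ∈ Y → z ∉ openCluster (ends '' (↑(s₀) : Set ι)) x ∧ z ∉ openCluster
                  (ends '' (↑(E.filter (fun i => ∀ y ∈ ends i, y ∈ Y) \ s₀) : Set ι)) x) := ⟨hP, hA⟩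
        rw [if_pos c1, if_pos c2, if_pos hB]
      · have c1 : ¬ ((Vs.filter (fun v : V => ∃ Y : Finset V, Y ⊆ Vs ∧ x ∈ Y ∧ w ∉ Y ∧
        (∀ t ∈ Y, t ≠ x → (∃ i ∈ E, ∃ t', ends i = s(t, t') ∧ t' ∉ Y) →
          t ∈ openCluster (ends '' (↑((s₀ ∪ s₁).filter (fun i => ∀ y ∈ ends i, y ∈ Y)) : Set ι)) x ∧ t ∈ openCluster (ends '' (↑((E \ (s₀
                ∪ s₁)).filter (fun i => ∀ y ∈ ends i, y ∈ Y)) : Set ι)) x) ∧ v ∈ Y)) = Y ∧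
            (∀ z ∈ Z, z ∉ openCluster (ends '' (↑(s₀ ∪ s₁) : Set ι)) x ∧ z ∉ openCluster (ends '' (↑(E \ (s₀
                  ∪ s₁)) : Set ι)) x)) := fun h => hB (hclass.mp h).2
        rw [if_neg c1, if_neg hB, mul_zero]
    · have c1 : ¬ ((Vs.filter (fun v : V => ∃ Y : Finset V, Y ⊆ Vs ∧ x ∈ Y ∧ w ∉ Y ∧
        (∀ t ∈ Y, t ≠ x → (∃ i ∈ E, ∃ t', ends i = s(t, t') ∧ t' ∉ Y) →
          t ∈ openCluster (ends '' (↑((s₀ ∪ s₁).filter (fun i => ∀ y ∈ ends i, y ∈ Y)) : Set ι)) x ∧ t ∈ openCluster (ends '' (↑((E \ (s₀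
                ∪ s₁)).filter (fun i => ∀ y ∈ ends i, y ∈ Y)) : Set ι)) x) ∧ v ∈ Y)) = Y ∧
          (∀ z ∈ Z, z ∉ openCluster (ends '' (↑(s₀ ∪ s₁) : Set ι)) x ∧ z ∉ openCluster (ends '' (↑(E \ (s₀
                ∪ s₁)) : Set ι)) x)) := fun h => hA (hclass.mp h).1.2
      have c2 : ¬ ((∀ t ∈ Y, t ≠ x → (∃ i ∈ E, ∃ t', ends i = s(t, t') ∧ t' ∉ Y) →
          t ∈ openCluster (ends '' (↑(s₀) : Set ι)) x ∧ t ∈ openCluster (ends '' (↑(E.filter (fun i => ∀ y ∈ ends i, y ∈ Y) \ s₀) : Set ι)) x) ∧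
          (∀ z ∈ Z, z ∈ Y → z ∉ openCluster (ends '' (↑(s₀) : Set ι)) x ∧ z ∉ openCluster
                (ends '' (↑(E.filter (fun i => ∀ y ∈ ends i, y ∈ Y) \ s₀) : Set ι)) x)) := fun h => hA h.2
      rw [if_neg c1, if_neg c2, zero_mul]
  rw [Finset.sum_congr rfl fun s₀ hs₀ => Finset.sum_congr rfl fun s₁ hs₁ => hterm s₀ hs₀ s₁ hs₁]
  rw [← Finset.sum_mul_sum, primeSum_single_eq_zero ends E Vs x w Z Y, mul_zero]

open Classical in
/-- **ISLAND FACTORISATION of the point row** (memo CW-RESIDUE-gen36 THEOREM 2.4):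
`Σ_{s ⊆ E : wall} σ_u σ_w = Σ_{Y
      ⊆ Vs : x ∈ Y, u ∉ Y, w ∉ Y} N_isl(Y) · R_Y` — every wall colouring factors uniquely through its maximal island, islands
containing `u` contribute nothing, and the rest is (island count) × (prime point-row sum of the quotient).
[cite: KozmaNitzan2024, Questions 8–9 (§5.5 p. 36) (context)] -/
theorem pointRow_eq_sum_islands (ends : ι → Sym2 V) (E : Finset ι) (Vs : Finset V) (x u w : V) (Z : Set V)
    (hxV : x ∈ Vs) (hwx : w ≠ x) :
    ∑ s ∈ E.powerset.filter (fun s : Finset ι => (∀ z ∈ Z, z ∉ openCluster (ends '' (↑(s) : Set ι)) x ∧ z ∉ openCluster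
          (ends '' (↑(E \ s) : Set ι)) x)),
      ((if u ∈ openCluster (ends '' (↑(s) : Set ι)) x then (1 : ℝ) else 0) - (if u ∈ openCluster (ends '' (↑(E \ s) : Set ι)) x then (1 : ℝ)
            else 0)) *
        ((if w ∈ openCluster (ends '' (↑(s) : Set ι)) x then (1 : ℝ) else 0) - (if w ∈ openCluster (ends '' (↑(E \ s) : Set ι)) x then (1 : ℝ)
              else 0))
    = ∑ Y ∈ Vs.powerset.filter (fun Y : Finset V => x ∈ Y ∧ u ∉ Y ∧ w ∉ Y),
      (((E.filter (fun i => ∀ y ∈ ends i, y ∈ Y)).powerset.filter (fun s₀ : Finset ι =>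
          (∀ t ∈ Y, t ≠ x → (∃ i ∈ E, ∃ t', ends i = s(t, t') ∧ t' ∉ Y) →
          t ∈ openCluster (ends '' (↑(s₀) : Set ι)) x ∧ t ∈ openCluster (ends '' (↑(E.filter (fun i => ∀ y ∈ ends i, y ∈ Y) \ s₀) : Set ι)) x) ∧
          (∀ z ∈ Z, z ∈ Y → z ∉ openCluster (ends '' (↑(s₀) : Set ι)) x ∧ z ∉ openCluster
                (ends '' (↑(E.filter (fun i => ∀ y ∈ ends i, y ∈ Y) \ s₀) : Set ι)) x))).card : ℝ) *
      ∑ s₁ ∈ (E \ E.filter (fun i => ∀ y ∈ ends i, y ∈ Y)).powerset.filter (fun s₁ : Finset ι =>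
          (∀ z ∈ Z, z ∉ Y → z ∉ openCluster (ends '' (↑(s₁ ∪ E.filter (fun i => ∀ y ∈ ends i, y ∈ Y)) : Set ι)) x ∧ z ∉ openCluster
                (ends '' (↑(((E \ E.filter (fun i => ∀ y ∈ ends i, y ∈ Y)) \ s₁) ∪ E.filter (fun i => ∀ y ∈ ends i, y ∈ Y)) : Set ι)) x) ∧
          (∀ Y' : Finset V, Y ⊆ Y' → Y ≠ Y' → Y' ⊆ Vs → w ∉ Y' →
          ¬ (∀ t ∈ Y', t ≠ x → (∃ i ∈ E, ∃ t', ends i = s(t, t') ∧ t' ∉ Y') →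
          t ∈ openCluster (ends '' (↑(((s₁ ∪ E.filter (fun i => ∀ y ∈ ends i, y ∈ Y))).filter (fun i => ∀ y ∈ ends i, y ∈ Y')) : Set ι)) x
                ∧ t ∈ openCluster (ends '' (↑((((E \ E.filter (fun i => ∀ y ∈ ends i, y ∈ Y)) \ s₁)
                ∪ E.filter (fun i => ∀ y ∈ ends i, y ∈ Y)).filter (fun i => ∀ y ∈ ends i, y ∈ Y')) : Set ι)) x))),
        ((if u ∈ openCluster (ends '' (↑(s₁ ∪ E.filter (fun i => ∀ y ∈ ends i, y ∈ Y)) : Set ι)) x then (1 : ℝ) else 0) - (if u ∈ openCluster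
              (ends '' (↑(((E \ E.filter (fun i => ∀ y ∈ ends i, y ∈ Y)) \ s₁) ∪ E.filter (fun i => ∀ y ∈ ends i, y ∈ Y)) : Set ι)) x
              then (1 : ℝ) else 0)) *
          ((if w ∈ openCluster (ends '' (↑(s₁ ∪ E.filter (fun i => ∀ y ∈ ends i, y ∈ Y)) : Set ι)) x then (1 : ℝ) else 0) - (if w ∈ openCluster
                (ends '' (↑(((E \ E.filter (fun i => ∀ y ∈ ends i, y ∈ Y)) \ s₁) ∪ E.filter (fun i => ∀ y ∈ ends i, y ∈ Y)) : Set ι)) x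
                then (1 : ℝ) else 0)) := by
  -- insert the maximal island as a second summation index
  have step1 : ∀ s ∈ E.powerset,
      (if (∀ z ∈ Z, z ∉ openCluster (ends '' (↑(s) : Set ι)) x ∧ z ∉ openCluster (ends '' (↑(E \ s) : Set ι)) x) then
        ((if u ∈ openCluster (ends '' (↑(s) : Set ι)) x then (1 : ℝ) else 0) - (if u ∈ openCluster (ends '' (↑(E \ s) : Set ι)) x then (1 : ℝ)
              else 0)) *
          ((if w ∈ openCluster (ends '' (↑(s) : Set ι)) x then (1 : ℝ) else 0) - (if w ∈ openCluster (ends '' (↑(E \ s) : Set ι)) x then (1 : ℝ)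
                else 0)) else 0)
      = ∑ Y ∈ Vs.powerset, (if (Vs.filter (fun v : V => ∃ Y : Finset V, Y ⊆ Vs ∧ x ∈ Y ∧ w ∉ Y ∧
        (∀ t ∈ Y, t ≠ x → (∃ i ∈ E, ∃ t', ends i = s(t, t') ∧ t' ∉ Y) →
          t ∈ openCluster (ends '' (↑((s).filter (fun i => ∀ y ∈ ends i, y ∈ Y)) : Set ι)) x ∧ t ∈ openCluster
                (ends '' (↑((E \ s).filter (fun i => ∀ y ∈ ends i, y ∈ Y)) : Set ι)) x) ∧ v ∈ Y)) = Y ∧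
            (∀ z ∈ Z, z ∉ openCluster (ends '' (↑(s) : Set ι)) x ∧ z ∉ openCluster (ends '' (↑(E \ s) : Set ι)) x)
          then ((if u ∈ openCluster (ends '' (↑(s) : Set ι)) x then (1 : ℝ) else 0) - (if u ∈ openCluster (ends '' (↑(E \ s) : Set ι)) x
                then (1 : ℝ) else 0)) *
            ((if w ∈ openCluster (ends '' (↑(s) : Set ι)) x then (1 : ℝ) else 0) - (if w ∈ openCluster (ends '' (↑(E \ s) : Set ι)) x
                  then (1 : ℝ) else 0)) else 0) := by
    intro s _
    have hmem : (Vs.filter (fun v : V => ∃ Y : Finset V, Y ⊆ Vs ∧ x ∈ Y ∧ w ∉ Y ∧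
        (∀ t ∈ Y, t ≠ x → (∃ i ∈ E, ∃ t', ends i = s(t, t') ∧ t' ∉ Y) →
          t ∈ openCluster (ends '' (↑((s).filter (fun i => ∀ y ∈ ends i, y ∈ Y)) : Set ι)) x ∧ t ∈ openCluster
                (ends '' (↑((E \ s).filter (fun i => ∀ y ∈ ends i, y ∈ Y)) : Set ι)) x)
                ∧ v ∈ Y)) ∈ Vs.powerset := Finset.mem_powerset.mpr (Finset.filter_subset _ _)
    simp only [ite_and]
    rw [Finset.sum_ite_eq, if_pos hmem]
  rw [Finset.sum_filter, Finset.sum_congr rfl step1, Finset.sum_comm]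
  -- split each colouring along `E_Y`
  rw [Finset.sum_filter]
  refine Finset.sum_congr rfl fun Y hY => ?_
  rw [Finset.mem_powerset] at hY
  have hEYE : E.filter (fun i => ∀ y ∈ ends i, y ∈ Y) ⊆ E := Finset.filter_subset _ _
  have hdisj : Disjoint (E.filter (fun i => ∀ y ∈ ends i, y ∈ Y)) (E \ E.filter (fun i => ∀ y ∈ ends i, y ∈ Y)) := Finset.disjoint_sdiff
  rw [show E.powerset = (E.filter (fun i => ∀ y ∈ ends i, y ∈ Y) ∪ (E \ E.filter (fun i => ∀ y ∈ ends i, y ∈ Y))).powerset by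
    rw [Finset.union_sdiff_of_subset hEYE]]
  rw [DualBHK.sum_powerset_union hdisj]
  by_cases hgood : x ∈ Y ∧ u ∉ Y ∧ w ∉ Y
  · rw [if_pos hgood]
    exact islandClass_sum ends E Vs x u w Z Y hY hgood.1 hgood.2.1 hgood.2.2 hwx
  · rw [if_neg hgood]
    by_cases hxY : x ∈ Y
    · by_cases hwY : w ∈ Y
      · -- `w ∈ Y`: no colouring has `Y_max = Y`
        refine Finset.sum_eq_zero fun s₀ _ => Finset.sum_eq_zero fun s₁ _ => ?_
        have c1 : ¬ ((Vs.filter (fun v : V => ∃ Y : Finset V, Y ⊆ Vs ∧ x ∈ Y ∧ w ∉ Y ∧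
        (∀ t ∈ Y, t ≠ x → (∃ i ∈ E, ∃ t', ends i = s(t, t') ∧ t' ∉ Y) →
          t ∈ openCluster (ends '' (↑((s₀ ∪ s₁).filter (fun i => ∀ y ∈ ends i, y ∈ Y)) : Set ι)) x ∧ t ∈ openCluster (ends '' (↑((E \ (s₀
                ∪ s₁)).filter (fun i => ∀ y ∈ ends i, y ∈ Y)) : Set ι)) x) ∧ v ∈ Y)) = Y ∧
            (∀ z ∈ Z, z ∉ openCluster (ends '' (↑(s₀ ∪ s₁) : Set ι)) x ∧ z ∉ openCluster (ends '' (↑(E \ (s₀ ∪ s₁)) : Set ι)) x)) := by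
          intro h
          have hm := (mem_islandSup ends E (s₀ ∪ s₁) x w Vs hxV hwx).2
          rw [h.1] at hm
          exact hm hwY
        rw [if_neg c1]
      · have huY : u ∈ Y := by
          by_contra huY
          exact hgood ⟨hxY, huY, hwY⟩
        exact islandClass_sum_eq_zero ends E Vs x u w Z Y hY hxY huY hwY hwx
    · refine Finset.sum_eq_zero fun s₀ _ => Finset.sum_eq_zero fun s₁ _ => ?_
      have c1 : ¬ ((Vs.filter (fun v : V => ∃ Y : Finset V, Y ⊆ Vs ∧ x ∈ Y ∧ w ∉ Y ∧
        (∀ t ∈ Y, t ≠ x → (∃ i ∈ E, ∃ t', ends i = s(t, t') ∧ t' ∉ Y) →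
          t ∈ openCluster (ends '' (↑((s₀ ∪ s₁).filter (fun i => ∀ y ∈ ends i, y ∈ Y)) : Set ι)) x ∧ t ∈ openCluster (ends '' (↑((E \ (s₀
                ∪ s₁)).filter (fun i => ∀ y ∈ ends i, y ∈ Y)) : Set ι)) x) ∧ v ∈ Y)) = Y ∧
          (∀ z ∈ Z, z ∉ openCluster (ends '' (↑(s₀ ∪ s₁) : Set ι)) x ∧ z ∉ openCluster (ends '' (↑(E \ (s₀ ∪ s₁)) : Set ι)) x)) := by
        intro h
        have hm := (mem_islandSup ends E (s₀ ∪ s₁) x w Vs hxV hwx).1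
        rw [h.1] at hm
        exact hxY hm
      rw [if_neg c1]

open Classical in
/-- **PRIME POSITIVITY ⟹ the point row.**  If every prime quotient sum `R_Y` (`Y ⊆ Vs`, `x ∈ Y`, `u, w ∉ Y`) is `≥ 0`, then the point row is `≥ 0`.
[cite: KozmaNitzan2024, Questions 8–9 (§5.5 p. 36) (context)] -/
theorem pointRow_nonneg_of_prime_nonneg (ends : ι → Sym2 V) (E : Finset ι) (Vs : Finset V) (x u w : V) (Z : Set V)
    (hxV : x ∈ Vs) (hwx : w ≠ x)
    (hprime : ∀ Y : Finset V, Y ⊆ Vs → x ∈ Y → u ∉ Y → w ∉ Y →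
      0 ≤ ∑ s₁ ∈ (E \ E.filter (fun i => ∀ y ∈ ends i, y ∈ Y)).powerset.filter (fun s₁ : Finset ι =>
          (∀ z ∈ Z, z ∉ Y → z ∉ openCluster (ends '' (↑(s₁ ∪ E.filter (fun i => ∀ y ∈ ends i, y ∈ Y)) : Set ι)) x ∧ z ∉ openCluster
                (ends '' (↑(((E \ E.filter (fun i => ∀ y ∈ ends i, y ∈ Y)) \ s₁) ∪ E.filter (fun i => ∀ y ∈ ends i, y ∈ Y)) : Set ι)) x) ∧
          (∀ Y' : Finset V, Y ⊆ Y' → Y ≠ Y' → Y' ⊆ Vs → w ∉ Y' →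
          ¬ (∀ t ∈ Y', t ≠ x → (∃ i ∈ E, ∃ t', ends i = s(t, t') ∧ t' ∉ Y') →
          t ∈ openCluster (ends '' (↑(((s₁ ∪ E.filter (fun i => ∀ y ∈ ends i, y ∈ Y))).filter (fun i => ∀ y ∈ ends i, y ∈ Y')) : Set ι)) x
                ∧ t ∈ openCluster (ends '' (↑((((E \ E.filter (fun i => ∀ y ∈ ends i, y ∈ Y)) \ s₁)
                ∪ E.filter (fun i => ∀ y ∈ ends i, y ∈ Y)).filter (fun i => ∀ y ∈ ends i, y ∈ Y')) : Set ι)) x))),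
        ((if u ∈ openCluster (ends '' (↑(s₁ ∪ E.filter (fun i => ∀ y ∈ ends i, y ∈ Y)) : Set ι)) x then (1 : ℝ) else 0) - (if u ∈ openCluster
              (ends '' (↑(((E \ E.filter (fun i => ∀ y ∈ ends i, y ∈ Y)) \ s₁) ∪ E.filter (fun i => ∀ y ∈ ends i, y ∈ Y)) : Set ι)) x
              then (1 : ℝ) else 0)) *
          ((if w ∈ openCluster (ends '' (↑(s₁ ∪ E.filter (fun i => ∀ y ∈ ends i, y ∈ Y)) : Set ι)) x then (1 : ℝ) else 0) - (if w ∈ openCluster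
                (ends '' (↑(((E \ E.filter (fun i => ∀ y ∈ ends i, y ∈ Y)) \ s₁) ∪ E.filter (fun i => ∀ y ∈ ends i, y ∈ Y)) : Set ι)) x
                then (1 : ℝ) else 0))) :
    0 ≤ ∑ s ∈ E.powerset.filter (fun s : Finset ι => (∀ z ∈ Z, z ∉ openCluster (ends '' (↑(s) : Set ι)) x ∧ z ∉ openCluster
          (ends '' (↑(E \ s) : Set ι)) x)),
      ((if u ∈ openCluster (ends '' (↑(s) : Set ι)) x then (1 : ℝ) else 0) - (if u ∈ openCluster (ends '' (↑(E \ s) : Set ι)) x then (1 : ℝ)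
            else 0)) *
        ((if w ∈ openCluster (ends '' (↑(s) : Set ι)) x then (1 : ℝ) else 0) - (if w ∈ openCluster (ends '' (↑(E \ s) : Set ι)) x then (1 : ℝ)
              else 0)) := by
  rw [pointRow_eq_sum_islands ends E Vs x u w Z hxV hwx]
  refine Finset.sum_nonneg fun Y hY => ?_
  rw [Finset.mem_filter, Finset.mem_powerset] at hY
  exact mul_nonneg (Nat.cast_nonneg _) (hprime Y hY.1 hY.2.1 hY.2.2.1 hY.2.2.2)

end Coefficientwise

end Summit.CriticalPhenomena.PercolationContinuityZ3.Theorems
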